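import Summits.Ventures.CertifiedArithmetic.Expansions.Orient2dStageBBounds
import Mathlib.Tactic.Linarith
import Mathlib.Tactic.Positivity
import Mathlib.Tactic.Ring
import Mathlib.Tactic.NormNum

/-!
# The stage-B estimate of `orient2dadapt` approximates the rounded-difference determinant

NEW WORK (Ventures).  With `x₁ = fl (a₁ − c₁)`, `x₂ = fl (b₂ − c₂)`, `x₃ = fl (a₂ − c₂)`,
`x₄ = fl (b₁ − c₁)`, `x₅ = x₁ ⊗ x₂`, `x₆ = x₃ ⊗ x₄`, `s = |x₅| + |x₆|`, `Σ = x₁x₂ − x₃x₄` (the exact sum of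
the block `B = Two_Two_Diff(Two_Product(x₁, x₂), Two_Product(x₃, x₄))`) and `det = estimate(4, B)`
(`orient2dDetB`):

* `abs_orient2dDetB_sub_le` — **`|det − Σ| ≤ (ε + 4ε²)|det| + (ε² + 3ε³)s`** (`p ≥ 4`, any
  round-to-nearest with `RoundoffBelow 2`, coordinates in `F(p, e₀)` with `emin ≤ e₀`,
  `emin + 2p ≤ 2e₀`, error-free two-products).  This is the shape-by-shape analysis done inside
  `orient2dStageB_correct` (`Orient2dStageB.lean`: `B₂ = 0` gives `ε|det| + (ε² + 2ε³ + ε⁴ + ε⁵)s`;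
  `B₂ ≠ 0` gives `ε|det| + 3ε²|B₃|` and `|Σ − B₃| ≤ 2ε|B₃|`), restated as ONE inequality and exported
  for the stage-C analysis (`Orient2dStageCBounds.lean`, hypothesis `hdB` of `stageC_sign_of_bounds`):
  in the second shape `(1 − 2ε − 3ε²)|B₃| ≤ (1 + ε)|det|`, so `3ε²|B₃| ≤ 4ε²|det|` for `ε ≤ 1/16`.

References: J. R. Shewchuk, Discrete Comput. Geom. 18 (1997) 305–363, §4.3 (Fig. 21) and
`predicates.c` (`orient2dadapt`, `estimate`) [Shewchuk1997].
-/

namespace Summit.Ventures.CertifiedArithmetic.Expansions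

open Literature.ComputerArithmetic.JeannerodRump2018
open Literature.ComputerArithmetic.BoldoJeannerodMelquiondMuller2023 hiding twoSum twoSum_fst isFloat_twoSum
open Literature.ComputerArithmetic.JoldesMullerPopescu2017 (isFloat_two_zpow abs_fl_le_of_abs_le)
open Literature.ComputerArithmetic.Shewchuk1997

variable {p : ℕ} {emin : ℤ} {fl : ℚ → ℚ}

/-- **The stage-B estimate is `Σ` up to `(ε + 4ε²)|det| + (ε² + 3ε³)s`.**  `p ≥ 4`, `fl` any
round-to-nearest into `F(p, emin)` with `RoundoffBelow 2` (e.g. ties-to-even), coordinates floats of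
`F(p, e₀)` with `emin ≤ e₀`, `emin + 2p ≤ 2e₀`, error-free two-products on the rounded differences. -/
theorem abs_orient2dDetB_sub_le (hp : 4 ≤ p) (hfl : IsRoundNearest p emin fl)
    (hfl2 : RoundoffBelow 2 fl) {e₀ : ℤ} (he₀ : emin ≤ e₀) (h2 : emin + 2 * p ≤ e₀ + e₀)
    {a₁ a₂ b₁ b₂ c₁ c₂ : ℚ} (ha₁ : IsFloat p e₀ a₁) (ha₂ : IsFloat p e₀ a₂) (hb₁ : IsFloat p e₀ b₁)
    (hb₂ : IsFloat p e₀ b₂) (hc₁ : IsFloat p e₀ c₁) (hc₂ : IsFloat p e₀ c₂)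
    {tp : ℚ → ℚ → ℚ × ℚ} (h₁₂ : ExactTwoProd p emin fl tp (fl (a₁ - c₁)) (fl (b₂ - c₂)))
    (h₃₄ : ExactTwoProd p emin fl tp (fl (a₂ - c₂)) (fl (b₁ - c₁))) :
    |orient2dDetB tp fl a₁ a₂ b₁ b₂ c₁ c₂ -
        (fl (a₁ - c₁) * fl (b₂ - c₂) - fl (a₂ - c₂) * fl (b₁ - c₁))| ≤
      (unitRoundoff p + 4 * unitRoundoff p ^ 2) * |orient2dDetB tp fl a₁ a₂ b₁ b₂ c₁ c₂| +
        (unitRoundoff p ^ 2 + 3 * unitRoundoff p ^ 3) *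
          (|fl (fl (a₁ - c₁) * fl (b₂ - c₂))| + |fl (fl (a₂ - c₂) * fl (b₁ - c₁))|) := by
  have hp1 : 1 ≤ p := le_trans (by norm_num) hp
  have he₂ : emin ≤ e₀ + e₀ := by omega
  have he₃ : emin ≤ -(2 * (p : ℤ)) + (e₀ + e₀) := by omega
  set u := unitRoundoff p with hu_def
  have hu0 : 0 < u := by rw [hu_def]; unfold unitRoundoff; positivity
  have hu16 : u ≤ 1 / 16 := Literature.ComputerArithmetic.BoldoMuller2011.unitRoundoff_le_sixteenth hp
  have hu1 : u < 1 := by linarith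
  -- the quantities of the analysis
  set t₁ := a₁ - c₁ with ht₁
  set t₂ := b₂ - c₂ with ht₂
  set t₃ := a₂ - c₂ with ht₃
  set t₄ := b₁ - c₁ with ht₄
  set x₁ := fl t₁ with hx₁
  set x₂ := fl t₂ with hx₂
  set x₃ := fl t₃ with hx₃
  set x₄ := fl t₄ with hx₄
  set x₅ := fl (x₁ * x₂) with hx₅
  set x₆ := fl (x₃ * x₄) with hx₆
  set det := orient2dDetB tp fl a₁ a₂ b₁ b₂ c₁ c₂ with hdet_def
  -- grids and floats
  have gt₁ : OnGrid e₀ t₁ := (OnGrid.of_isFloat ha₁).sub (OnGrid.of_isFloat hc₁)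
  have gt₂ : OnGrid e₀ t₂ := (OnGrid.of_isFloat hb₂).sub (OnGrid.of_isFloat hc₂)
  have gt₃ : OnGrid e₀ t₃ := (OnGrid.of_isFloat ha₂).sub (OnGrid.of_isFloat hc₂)
  have gt₄ : OnGrid e₀ t₄ := (OnGrid.of_isFloat hb₁).sub (OnGrid.of_isFloat hc₁)
  have gx₁ : OnGrid e₀ x₁ := gt₁.fl_of hp1 hfl he₀
  have gx₂ : OnGrid e₀ x₂ := gt₂.fl_of hp1 hfl he₀
  have gx₃ : OnGrid e₀ x₃ := gt₃.fl_of hp1 hfl he₀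
  have gx₄ : OnGrid e₀ x₄ := gt₄.fl_of hp1 hfl he₀
  have g₁₂ : OnGrid (e₀ + e₀) (x₁ * x₂) := gx₁.mul gx₂
  have g₃₄ : OnGrid (e₀ + e₀) (x₃ * x₄) := gx₃.mul gx₄
  have gx₅ : OnGrid (e₀ + e₀) x₅ := g₁₂.fl_of hp1 hfl he₂
  have gx₆ : OnGrid (e₀ + e₀) x₆ := g₃₄.fl_of hp1 hfl he₂
  have hx5F : IsFloat p emin x₅ := (hfl _).1
  have hx6F : IsFloat p emin x₆ := (hfl _).1
  -- the block `B = ⟨B₀, B₁, B₂, B₃⟩` and its internals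
  have hx5e : (tp x₁ x₂).1 = x₅ := h₁₂.1
  have hx6e : (tp x₃ x₄).1 = x₆ := h₃₄.1
  set a0 := (tp x₁ x₂).2 with ha0_def
  set b0 := (tp x₃ x₄).2 with hb0_def
  have ha0 : a0 = x₁ * x₂ - x₅ := by have := h₁₂.2.1; rw [hx5e] at this; linarith
  have hb0 : b0 = x₃ * x₄ - x₆ := by have := h₃₄.2.1; rw [hx6e] at this; linarith
  have ha0F : IsFloat p emin a0 := h₁₂.2.2
  have hb0F : IsFloat p emin b0 := h₃₄.2.2
  have hblock : twoTwoProdDiff tp fl x₁ x₂ x₃ x₄ = twoTwoDiff fl x₅ a0 x₆ b0 := by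
    show twoTwoDiff fl (tp x₁ x₂).1 a0 (tp x₃ x₄).1 b0 = _
    rw [hx5e, hx6e]
  rw [twoTwoDiff_eq] at hblock
  set T1 := twoSum fl (-b0) a0 with hT1
  set T2 := twoSum fl T1.1 x₅ with hT2
  set T3 := twoSum fl (-x₆) T2.2 with hT3
  set T4 := twoSum fl T3.1 T2.1 with hT4
  have hT1F : IsFloat p emin T1.1 ∧ IsFloat p emin T1.2 := isFloat_twoSum hfl (-b0) a0
  have hT2F : IsFloat p emin T2.1 ∧ IsFloat p emin T2.2 := isFloat_twoSum hfl T1.1 x₅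
  have hT3F : IsFloat p emin T3.1 ∧ IsFloat p emin T3.2 := isFloat_twoSum hfl (-x₆) T2.2
  have hT4F : IsFloat p emin T4.1 ∧ IsFloat p emin T4.2 := isFloat_twoSum hfl T3.1 T2.1
  have e1 : T1.2 = -b0 + a0 - fl (-b0 + a0) ∧ T1.1 + T1.2 = -b0 + a0 :=
    twoSum_exact hp1 hfl hb0F.neg ha0F
  have e2 : T2.2 = T1.1 + x₅ - fl (T1.1 + x₅) ∧ T2.1 + T2.2 = T1.1 + x₅ :=
    twoSum_exact hp1 hfl hT1F.1 hx5F
  have e3 : T3.2 = -x₆ + T2.2 - fl (-x₆ + T2.2) ∧ T3.1 + T3.2 = -x₆ + T2.2 :=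
    twoSum_exact hp1 hfl hx6F.neg hT2F.2
  have e4 : T4.2 = T3.1 + T2.1 - fl (T3.1 + T2.1) ∧ T4.1 + T4.2 = T3.1 + T2.1 :=
    twoSum_exact hp1 hfl hT3F.1 hT2F.1
  have hT11 : T1.1 = fl (-b0 + a0) := rfl
  have hT41 : T4.1 = fl (T3.1 + T2.1) := rfl
  have gT11 : OnGrid emin T1.1 := OnGrid.of_isFloat hT1F.1
  have gT12 : OnGrid emin T1.2 := OnGrid.of_isFloat hT1F.2
  have gT21 : OnGrid emin T2.1 := OnGrid.of_isFloat hT2F.1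
  have gT22 : OnGrid emin T2.2 := OnGrid.of_isFloat hT2F.2
  have gT31 : OnGrid emin T3.1 := OnGrid.of_isFloat hT3F.1
  have gT32 : OnGrid emin T3.2 := OnGrid.of_isFloat hT3F.2
  have gT41 : OnGrid emin T4.1 := OnGrid.of_isFloat hT4F.1
  have gT42 : OnGrid emin T4.2 := OnGrid.of_isFloat hT4F.2
  -- `det = ((B₀ ⊕ B₁) ⊕ B₂) ⊕ B₃` and `Σ B = x₁x₂ − x₃x₄`
  have hdet : det = fl (fl (fl (T1.2 + T3.2) + T4.2) + T4.1) := by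
    show estimate fl (twoTwoProdDiff tp fl x₁ x₂ x₃ x₄) = _
    rw [hblock, estimate_four]
  have hsig : T1.2 + T3.2 + T4.2 + T4.1 = x₁ * x₂ - x₃ * x₄ := by
    linarith [e1.2, e2.2, e3.2, e4.2]
  have hexp : IsExpansion 1 [T1.2, T3.2, T4.2, T4.1] := by
    have h := (twoTwoProdDiff_spec hp1 hfl hfl2 h₁₂ h₃₄).1.isExpansion
    rwa [hblock] at h
  set B0 := T1.2 with hB0
  set B1 := T3.2 with hB1
  set B2 := T4.2 with hB2
  set B3 := T4.1 with hB3
  set Q1 := fl (B0 + B1) with hQ1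
  set Q2 := fl (Q1 + B2) with hQ2
  have hQ1F : IsFloat p emin Q1 := (hfl _).1
  have hQ2F : IsFloat p emin Q2 := (hfl _).1
  -- the three roundings of `estimate` and the size of `B₂`
  have r1 : |B0 + B1 - Q1| ≤ u * |B0 + B1| :=
    abs_sub_fl_le_eps_mul_abs hp1 hfl le_rfl (gT12.add gT32)
  have r2 : |Q1 + B2 - Q2| ≤ u * |Q1 + B2| :=
    abs_sub_fl_le_eps_mul_abs hp1 hfl le_rfl ((OnGrid.of_isFloat hQ1F).add gT42)
  have r3 : |Q2 + B3 - det| ≤ u * |det| := by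
    rw [hdet]
    exact abs_sub_fl_le_eps_mul_abs_fl hp1 hfl le_rfl ((OnGrid.of_isFloat hQ2F).add gT41)
  have rB2 : |B2| ≤ u * |B3| := by
    have h : |T3.1 + T2.1 - fl (T3.1 + T2.1)| ≤ u * |fl (T3.1 + T2.1)| :=
      abs_sub_fl_le_eps_mul_abs_fl hp1 hfl le_rfl (gT31.add gT21)
    rw [← e4.1, ← hT41] at h
    exact h
  have hdecomp : x₁ * x₂ - x₃ * x₄ - det = (B0 + B1 - Q1) + (Q1 + B2 - Q2) + (Q2 + B3 - det) := by
    rw [← hsig]; ring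
  -- `Σ = det ± …` in one of the two shapes of the core lemma
  have hQ : (|(x₁ * x₂ - x₃ * x₄) - det| ≤ u * |det| + 3 * u ^ 2 * |B3| ∧
        |(x₁ * x₂ - x₃ * x₄) - B3| ≤ 2 * u * |B3|) ∨
      |(x₁ * x₂ - x₃ * x₄) - det| ≤ u * |det| + (u ^ 2 + 2 * u ^ 3 + u ^ 4 + u ^ 5) * (|x₅| + |x₆|) := by
    by_cases hB2z : B2 = 0
    · -- `B₂ = 0`: `Q₂ = Q₁`, and `B₀, B₁` are tiny: `|B₀ + B₁| ≤ (ε + ε² + ε³ + ε⁴)s`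
      right
      have hQ21 : Q2 = Q1 := by rw [hQ2, hB2z, add_zero]; exact fl_eq_self hfl hQ1F
      have ra0 : |a0| ≤ u * |x₅| := by
        rw [ha0]; exact abs_sub_fl_le_eps_mul_abs_fl hp1 hfl he₂ g₁₂
      have rb0 : |b0| ≤ u * |x₆| := by
        rw [hb0]; exact abs_sub_fl_le_eps_mul_abs_fl hp1 hfl he₂ g₃₄
      have gab : OnGrid emin (-b0 + a0) := (OnGrid.of_isFloat hb0F).neg.add (OnGrid.of_isFloat ha0F)
      have rB0 : |B0| ≤ u * |-b0 + a0| := by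
        rw [e1.1]; exact abs_sub_fl_le_eps_mul_abs hp1 hfl le_rfl gab
      have rT11 : |T1.1| ≤ (1 + u) * |-b0 + a0| := by
        have h := abs_sub_fl_le_eps_mul_abs hp1 hfl le_rfl gab
        rw [hT11]
        have := abs_sub_abs_le_abs_sub (fl (-b0 + a0)) (-b0 + a0)
        rw [abs_sub_comm (fl (-b0 + a0)) (-b0 + a0)] at this
        linarith
      have rT22 : |T2.2| ≤ u * |T1.1 + x₅| := by
        rw [e2.1]
        exact abs_sub_fl_le_eps_mul_abs hp1 hfl le_rfl (gT11.add (OnGrid.of_isFloat hx5F))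
      have rB1 : |B1| ≤ u * |-x₆ + T2.2| := by
        rw [e3.1]
        exact abs_sub_fl_le_eps_mul_abs hp1 hfl le_rfl ((OnGrid.of_isFloat hx6F).neg.add gT22)
      have hab : |-b0 + a0| ≤ u * (|x₅| + |x₆|) := by
        calc |-b0 + a0| ≤ |-b0| + |a0| := abs_add_le _ _
          _ = |b0| + |a0| := by rw [abs_neg]
          _ ≤ u * |x₆| + u * |x₅| := add_le_add rb0 ra0
          _ = u * (|x₅| + |x₆|) := by ring
      have hB0' : |B0| ≤ u ^ 2 * (|x₅| + |x₆|) := by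
        calc |B0| ≤ u * |-b0 + a0| := rB0
          _ ≤ u * (u * (|x₅| + |x₆|)) := mul_le_mul_of_nonneg_left hab hu0.le
          _ = u ^ 2 * (|x₅| + |x₆|) := by ring
      have hT22' : |T2.2| ≤ u * |x₅| + (u ^ 2 + u ^ 3) * (|x₅| + |x₆|) := by
        calc |T2.2| ≤ u * |T1.1 + x₅| := rT22
          _ ≤ u * (|T1.1| + |x₅|) := mul_le_mul_of_nonneg_left (abs_add_le _ _) hu0.le
          _ ≤ u * ((1 + u) * (u * (|x₅| + |x₆|)) + |x₅|) := by
              apply mul_le_mul_of_nonneg_left _ hu0.le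
              have := rT11.trans (mul_le_mul_of_nonneg_left hab (by linarith))
              linarith
          _ = u * |x₅| + (u ^ 2 + u ^ 3) * (|x₅| + |x₆|) := by ring
      have hB1' : |B1| ≤ u * |x₆| + u ^ 2 * |x₅| + (u ^ 3 + u ^ 4) * (|x₅| + |x₆|) := by
        calc |B1| ≤ u * |-x₆ + T2.2| := rB1
          _ ≤ u * (|-x₆| + |T2.2|) := mul_le_mul_of_nonneg_left (abs_add_le _ _) hu0.le
          _ = u * (|x₆| + |T2.2|) := by rw [abs_neg]
          _ ≤ u * (|x₆| + (u * |x₅| + (u ^ 2 + u ^ 3) * (|x₅| + |x₆|))) :=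
              mul_le_mul_of_nonneg_left (by linarith) hu0.le
          _ = u * |x₆| + u ^ 2 * |x₅| + (u ^ 3 + u ^ 4) * (|x₅| + |x₆|) := by ring
      have h01 : |B0 + B1| ≤ (u + u ^ 2 + u ^ 3 + u ^ 4) * (|x₅| + |x₆|) := by
        have hu2 : u ^ 2 * |x₅| ≤ u * |x₅| := by
          have h : u * u < u * 1 := mul_lt_mul_of_pos_left hu1 hu0
          rw [mul_one, ← pow_two] at h
          exact mul_le_mul_of_nonneg_right h.le (abs_nonneg _)
        calc |B0 + B1| ≤ |B0| + |B1| := abs_add_le _ _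
          _ ≤ u ^ 2 * (|x₅| + |x₆|) +
              (u * |x₆| + u ^ 2 * |x₅| + (u ^ 3 + u ^ 4) * (|x₅| + |x₆|)) := add_le_add hB0' hB1'
          _ ≤ (u + u ^ 2 + u ^ 3 + u ^ 4) * (|x₅| + |x₆|) := by linarith [hu2, abs_nonneg x₆]
      rw [hdecomp, hQ21]
      have hmid : Q1 + B2 - Q1 = 0 := by rw [hB2z]; ring
      rw [hmid, add_zero]
      calc |(B0 + B1 - Q1) + (Q1 + B3 - det)| ≤ |B0 + B1 - Q1| + |Q1 + B3 - det| := abs_add_le _ _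
        _ ≤ u * |B0 + B1| + u * |det| := by
            have r3' : |Q1 + B3 - det| ≤ u * |det| := by rw [← hQ21]; exact r3
            exact add_le_add r1 r3'
        _ ≤ u * ((u + u ^ 2 + u ^ 3 + u ^ 4) * (|x₅| + |x₆|)) + u * |det| := by
            have := mul_le_mul_of_nonneg_left h01 hu0.le
            linarith
        _ = u * |det| + (u ^ 2 + u ^ 3 + u ^ 4 + u ^ 5) * (|x₅| + |x₆|) := by ring
        _ ≤ u * |det| + (u ^ 2 + 2 * u ^ 3 + u ^ 4 + u ^ 5) * (|x₅| + |x₆|) := by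
            have : 0 ≤ u ^ 3 * (|x₅| + |x₆|) := by positivity
            linarith
    · -- `B₂ ≠ 0`: `|B₀ + B₁| < |B₂|` and `|Q₁| ≤ |B₂| ≤ ε|B₃|`
      left
      have hpw := hexp
      simp only [IsExpansion, List.pairwise_cons, List.mem_cons, List.mem_nil_iff, or_false,
        forall_eq_or_imp, forall_eq, List.Pairwise.nil, and_true] at hpw
      obtain ⟨⟨h01, h02, -⟩, ⟨h12, -⟩, -⟩ := hpw
      obtain ⟨hlt, hle⟩ := abs_fl_add_le_of_below hp1 hfl hT1F.2 hT3F.2 hT4F.2 hB2z h01 h02 h12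
      constructor
      · rw [hdecomp]
        calc |(B0 + B1 - Q1) + (Q1 + B2 - Q2) + (Q2 + B3 - det)|
              ≤ |(B0 + B1 - Q1) + (Q1 + B2 - Q2)| + |Q2 + B3 - det| := abs_add_le _ _
          _ ≤ |B0 + B1 - Q1| + |Q1 + B2 - Q2| + |Q2 + B3 - det| := by
              linarith [abs_add_le (B0 + B1 - Q1) (Q1 + B2 - Q2)]
          _ ≤ u * |B0 + B1| + u * |Q1 + B2| + u * |det| := add_le_add (add_le_add r1 r2) r3
          _ ≤ u * |B2| + u * (|B2| + |B2|) + u * |det| := by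
              have h1 : u * |B0 + B1| ≤ u * |B2| := mul_le_mul_of_nonneg_left hlt.le hu0.le
              have h2 : u * |Q1 + B2| ≤ u * (|B2| + |B2|) :=
                mul_le_mul_of_nonneg_left ((abs_add_le _ _).trans (by linarith)) hu0.le
              linarith
          _ = u * |det| + 3 * u * |B2| := by ring
          _ ≤ u * |det| + 3 * u * (u * |B3|) := by
              have := mul_le_mul_of_nonneg_left rB2 (by positivity : (0 : ℚ) ≤ 3 * u)
              linarith
          _ = u * |det| + 3 * u ^ 2 * |B3| := by ring
      · have : x₁ * x₂ - x₃ * x₄ - B3 = (B0 + B1) + B2 := by rw [← hsig]; ring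
        rw [this]
        calc |(B0 + B1) + B2| ≤ |B0 + B1| + |B2| := abs_add_le _ _
          _ ≤ |B2| + |B2| := by linarith
          _ ≤ u * |B3| + u * |B3| := add_le_add rB2 rB2
          _ = 2 * u * |B3| := by ring
  -- one inequality out of the two shapes
  rcases hQ with ⟨hQ', hb'⟩ | hQ'
  · -- `(1 − 2ε − 3ε²)|B₃| ≤ (1 + ε)|det|`, hence `3|B₃| ≤ 4|det|`
    have hB3a : |B3| ≤ |x₁ * x₂ - x₃ * x₄| + 2 * u * |B3| := by
      have := abs_sub_abs_le_abs_sub B3 (x₁ * x₂ - x₃ * x₄)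
      rw [abs_sub_comm B3 _] at this
      linarith
    have hSa : |x₁ * x₂ - x₃ * x₄| ≤ |det| + u * |det| + 3 * u ^ 2 * |B3| := by
      have := abs_sub_abs_le_abs_sub (x₁ * x₂ - x₃ * x₄) det
      linarith
    have hc : (1 - 2 * u - 3 * u ^ 2) * |B3| ≤ (1 + u) * |det| := by linarith [hB3a, hSa]
    have hu2 : u ^ 2 ≤ u / 16 := by
      rw [pow_two]
      have := mul_le_mul_of_nonneg_left hu16 hu0.le
      linarith
    have h34 : 3 * |B3| ≤ 4 * |det| := by
      have hpos : 0 < 1 - 2 * u - 3 * u ^ 2 := by linarith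
      have hcoef : 3 * (1 + u) ≤ 4 * (1 - 2 * u - 3 * u ^ 2) := by linarith
      have h1 : 3 * ((1 - 2 * u - 3 * u ^ 2) * |B3|) ≤ 3 * ((1 + u) * |det|) := by linarith
      have h2 : 3 * ((1 + u) * |det|) ≤ 4 * (1 - 2 * u - 3 * u ^ 2) * |det| := by
        have := mul_le_mul_of_nonneg_right hcoef (abs_nonneg det)
        linarith
      have h3 : (1 - 2 * u - 3 * u ^ 2) * (3 * |B3|) ≤ (1 - 2 * u - 3 * u ^ 2) * (4 * |det|) := by
        linarith
      exact le_of_mul_le_mul_left h3 hpos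
    have h34' : 3 * u ^ 2 * |B3| ≤ 4 * u ^ 2 * |det| := by
      have := mul_le_mul_of_nonneg_left h34 (pow_nonneg hu0.le 2)
      linarith
    rw [abs_sub_comm]
    have hs0 : 0 ≤ (u ^ 2 + 3 * u ^ 3) * (|x₅| + |x₆|) := by positivity
    linarith
  · rw [abs_sub_comm]
    have h1 : (u ^ 2 + 2 * u ^ 3 + u ^ 4 + u ^ 5) * (|x₅| + |x₆|) ≤
        (u ^ 2 + 3 * u ^ 3) * (|x₅| + |x₆|) := by
      apply mul_le_mul_of_nonneg_right _ (by positivity)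
      have hu4 : u ^ 4 ≤ u ^ 3 / 2 := by
        have := mul_le_mul_of_nonneg_left (show u ≤ 1 / 2 by linarith) (pow_nonneg hu0.le 3)
        calc u ^ 4 = u ^ 3 * u := by ring
          _ ≤ u ^ 3 * (1 / 2) := this
          _ = u ^ 3 / 2 := by ring
      have hu5 : u ^ 5 ≤ u ^ 3 / 2 := by
        have h' : u ^ 2 ≤ 1 / 2 := by
          have h16 := mul_le_mul_of_nonneg_left hu16 hu0.le
          rw [pow_two]; linarith
        have := mul_le_mul_of_nonneg_left h' (pow_nonneg hu0.le 3)
        calc u ^ 5 = u ^ 3 * u ^ 2 := by ring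
          _ ≤ u ^ 3 * (1 / 2) := this
          _ = u ^ 3 / 2 := by ring
      linarith
    have h2 : 0 ≤ 4 * u ^ 2 * |det| := by positivity
    linarith

end Summit.Ventures.CertifiedArithmetic.Expansions
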